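import Literature.NumberTheory.IwasawaTheory.NarrowFukudaCertificateLayerModels
import Literature.NumberTheory.EllipticCurves.CyclotomicZpExtensionLayerGeneratorProofs
import HarnessLib

/-!
# NARROW FUKUDA — the layer-`2` model `K_2 ≅ K(√(2+√2))` of an odd-degree number field and the `n = 1` rung of the narrow rank
# certificate: «`rank₂ Cl⁺(K_2) = rank₂ Cl⁺(K_1)`» for fields whose narrow `2`-rank grows once between `K` and `K(√2)`

Topic `NumberTheory/IwasawaTheory` (namespace = path). THEOREM-ONLY file (no definition, no named fact, no `sorry`), written by the prover seat
`cruxlead-stmt-BirchSwinnertonDyer-19573-w2` GEN 10 (cell `bsd-2adic`; `--supports` stmt-BirchSwinnertonDyer-19573; closes nothing).  Sequel of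
`NarrowFukudaCertificateLayerModels.lean` (GEN 9: `K_0 ≅ K`, `K_1 ≅ K(√2)`, `NarrowFukuda.narrowMu_of_layerOne_model`).  Fukuda's Theorem 1 (2) for
narrow class groups (`NarrowFukuda.index_range_pow_narrowClassGroup_eq_of_succ_eq`) needs ONE pair of consecutive layers `n, n+1` with `n ≥ n₀` and equal
narrow `p`-ranks; when the narrow `2`-rank of `K_1 = K(√2)` exceeds that of `K` the pair `(0, 1)` fails and the next pair is `(1, 2)` — so a concrete model
of `K_2` is wanted.  For `[K:ℚ]` odd, `K_2 = K·ℚ_2` with `ℚ_2 = ℚ(ζ₁₆)⁺ = ℚ(√(2+√2))` (Washington §13.1; tree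
`ZpExtension.IsCyclotomic.exists_quartic_root_layer_two`: `ℚ_2` contains a root of `X⁴ − 4X² + 2`), and `X⁴ − 4X² + 2` stays irreducible over `K`
(its root field contains `√2 ∉ K`, and `2 + √2` is not a square in `K(√2)`), so ANY extension `L/K` of degree `4` containing a root of `X⁴ − 4X² + 2` is
`K`-isomorphic to `K_2`.

* §1 `X⁴ − 4X² + 2` over an odd-degree number field `K`: no root in `K` (`quartic_ne_zero_of_odd_finrank`); **`minpoly_eq_quartic_of_odd_finrank`** (the
  minimal polynomial over `K` of ANY root in ANY extension is `X⁴ − 4X² + 2`); `irreducible_quartic_of_odd_finrank`; `finrank_adjoin_quartic_root`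
  (`[K(θ):K] = 4`); `nonempty_algEquiv_of_quartic_root_of_odd_finrank` (two degree-`4` extensions of `K` with a root are `K`-isomorphic).
* §2 `exists_quartic_root_layer_two_of_not_dvd_finrank` (`K_2 ∋ θ` with `θ⁴ − 4θ² + 2 = 0`, every cyclotomic `ℤ₂`-extension, `2 ∤ [K:ℚ]`),
  `nonempty_algEquiv_layer_two_of_quartic_root` (`K_2 ≃ₐ[K] L`), `index_range_pow_narrowClassGroup_layer_two_eq` (transport of `[Cl⁺ : (Cl⁺)^q]`).
* §3 **`NarrowFukuda.narrowMu_of_layerTwo_model`** — `[K:ℚ]` odd, Fukuda index `≤ 1` for every cyclotomic `ℤ₂`-extension (index `0` suffices,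
  `TotallyRamifiedFrom.mono`; tree criteria `forall_totallyRamifiedFrom_zero_of_not_dvd_discr`, `totallyRamifiedFrom_zero_of_evenIndexCertificate`), a model
  `L₁ ⊇ K` of `K(√2)` (degree `2`, `θ₁² = 2`) and a model `L₂ ⊇ K` of `K_2` (degree `4`, `θ₂⁴ − 4θ₂² + 2 = 0`) with
  **`[Cl⁺(L₂) : Cl⁺(L₂)²] = [Cl⁺(L₁) : Cl⁺(L₁)²]`** ⟹ (a) `μ₂ = 0` for every cyclotomic `ℤ₂`-extension of `K` ∧ (b)
  `ord₂ h⁺(K_m) ≤ ord₂ h(K_m) + max (rank₂ Cl⁺(K)) (rank₂ Cl⁺(L₁))` for every layer — Kida-lite's hypotheses from ONE equality between the narrow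
  `2`-ranks of two concrete fields of degrees `4[K:ℚ]` and `2[K:ℚ]`; `…_of_not_dvd_discr_of_layerTwo_model` (the case `2 ∤ d_K`, fully explicit) and
  `…_of_index_zero_of_layerTwo_model` (Fukuda index `0`).

What this file does NOT do: assert any certificate for any field (each equality of narrow ranks is a finite class-group computation per field, e.g. the
`bnfnarrow` tables of the cell's numerics); prove `[K(√2) ∩ K¹ : K] = 1`-type monotonicity of the narrow rank (the bound in (b) is a `max`, no comparison
of the ranks of `K` and `K(√2)` is claimed).  BSD is not proved by any of this.

References: [Fukuda1994] T. Fukuda, *Remarks on ℤ_p-extensions of number fields*, Proc. Japan Acad. 70 (1994), Thm. 1 (2), p. 264; [Washington1997] §13.1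
(`ℚ_n = ℚ(ζ_{2^{n+2}})⁺`, `K_n = K·ℚ_n`), §13.3; [Kida1982JFields] (μ-part; shape); [FrohlichTaylor1990] Ch. V §1.
-/

set_option autoImplicit false

noncomputable section

open scoped NumberField Polynomial IntermediateField
open NumberField Field Polynomial

namespace Literature.NumberTheory.IwasawaTheory

open Literature.NumberTheory.EllipticCurves Literature.NumberTheory.NumberFields Literature.NumberTheory.GaloisRepresentations

variable {K : Type} [Field K] [NumberField K]

/-! ## §1 `X⁴ − 4X² + 2` over a number field of odd degree -/

section Quartic

omit [NumberField K] in
/-- `X⁴ − 4X² + 2 ∈ K[X]` is monic. [folklore] -/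
private theorem monic_quartic : (X ^ 4 - C (4 : K) * X ^ 2 + C 2 : K[X]).Monic := by
  monicity!

omit [NumberField K] in
/-- `X⁴ − 4X² + 2 ∈ K[X]` has degree `4`. [folklore] -/
private theorem natDegree_quartic : (X ^ 4 - C (4 : K) * X ^ 2 + C 2 : K[X]).natDegree = 4 := by
  compute_degree!

omit [NumberField K] in
/-- `X⁴ − 4X² + 2 ≠ 0`. [folklore] -/
private theorem quartic_ne_zero' : (X ^ 4 - C (4 : K) * X ^ 2 + C 2 : K[X]) ≠ 0 := monic_quartic.ne_zero

omit [NumberField K] in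
/-- Evaluation of `X⁴ − 4X² + 2`. [folklore] -/
private theorem aeval_quartic {L : Type*} [Field L] [Algebra K L] (θ : L) :
    aeval θ (X ^ 4 - C (4 : K) * X ^ 2 + C 2 : K[X]) = θ ^ 4 - 4 * θ ^ 2 + 2 := by
  simp only [map_add, map_sub, map_mul, map_pow, aeval_X, map_ofNat]

omit [NumberField K] in
/-- Evaluation of `X⁴ − 4X² + 2` in `K`. [folklore] -/
private theorem eval_quartic (x : K) : eval x (X ^ 4 - C (4 : K) * X ^ 2 + C 2 : K[X]) = x ^ 4 - 4 * x ^ 2 + 2 := by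
  simp only [eval_add, eval_sub, eval_mul, eval_pow, eval_X, eval_C]

/-- **`X⁴ − 4X² + 2` has no root in a number field `K` of odd degree**: a root `x` gives `(x² − 2)² = 2`, i.e. `√2 ∈ K`.
[cite: Washington1997, §13.1 (`K ∩ ℚ_∞ = ℚ` for `[K:ℚ]` odd; `ℚ_1 = ℚ(√2)`)] -/
theorem quartic_ne_zero_of_odd_finrank (hodd : Odd (Module.finrank ℚ K)) (x : K) : x ^ 4 - 4 * x ^ 2 + 2 ≠ 0 := by
  intro hx
  exact sq_ne_two_of_odd_finrank hodd (x ^ 2 - 2) (by linear_combination hx)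

/-- The obstruction at degree `2`: a root `θ ∉ K` of `X⁴ − 4X² + 2` (over an odd-degree `K`) satisfies no relation `θ² = c₁θ + c₀` with
`c₀, c₁ ∈ K` — otherwise `θ⁴ − 4θ² + 2 = Aθ + B` with `A = c₁(c₁² + 2c₀ − 4)`, `B = c₁²c₀ + c₀² − 4c₀ + 2`, forcing `A = B = 0` and then
`(c₀ − 2)² = 2` or `c₀² = 2` in `K`. [cite: Washington1997, §13.1] -/
private theorem false_of_sq_eq_of_quartic_root (hodd : Odd (Module.finrank ℚ K)) {L : Type*} [Field L] [Algebra K L] {θ : L}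
    (hθ : θ ^ 4 - 4 * θ ^ 2 + 2 = 0) (hθK : θ ∉ (algebraMap K L).range) (c₀ c₁ : K)
    (h : θ ^ 2 = algebraMap K L c₁ * θ + algebraMap K L c₀) : False := by
  set a : L := algebraMap K L c₁ with ha
  set b : L := algebraMap K L c₀ with hb
  have hAB : (a ^ 3 + 2 * a * b - 4 * a) * θ + (a ^ 2 * b + b ^ 2 - 4 * b + 2) = 0 := by
    linear_combination hθ - (θ ^ 2 + a * θ + a ^ 2 + b - 4) * h
  have hA : algebraMap K L (c₁ ^ 3 + 2 * c₁ * c₀ - 4 * c₁) = a ^ 3 + 2 * a * b - 4 * a := by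
    simp only [map_add, map_sub, map_mul, map_pow, map_ofNat, ha, hb]
  have hB : algebraMap K L (c₁ ^ 2 * c₀ + c₀ ^ 2 - 4 * c₀ + 2) = a ^ 2 * b + b ^ 2 - 4 * b + 2 := by
    simp only [map_add, map_sub, map_mul, map_pow, map_ofNat, ha, hb]
  rw [← hA, ← hB] at hAB
  -- `A = 0`, else `θ ∈ K`
  have hA0 : c₁ ^ 3 + 2 * c₁ * c₀ - 4 * c₁ = 0 := by
    by_contra hne
    have hne' : algebraMap K L (c₁ ^ 3 + 2 * c₁ * c₀ - 4 * c₁) ≠ 0 := by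
      rwa [Ne, map_eq_zero_iff _ (algebraMap K L).injective]
    apply hθK
    refine ⟨-(c₁ ^ 2 * c₀ + c₀ ^ 2 - 4 * c₀ + 2) / (c₁ ^ 3 + 2 * c₁ * c₀ - 4 * c₁), ?_⟩
    rw [map_div₀, map_neg, div_eq_iff hne']
    linear_combination -hAB
  have hB0 : c₁ ^ 2 * c₀ + c₀ ^ 2 - 4 * c₀ + 2 = 0 := by
    rw [hA0, map_zero, zero_mul, zero_add, map_eq_zero_iff _ (algebraMap K L).injective] at hAB
    exact hAB
  have hfac : c₁ * (c₁ ^ 2 + 2 * c₀ - 4) = 0 := by linear_combination hA0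
  rcases mul_eq_zero.mp hfac with hc₁ | hc₁
  · -- `c₁ = 0`: `(c₀ − 2)² = 2`
    rw [hc₁] at hB0
    exact sq_ne_two_of_odd_finrank hodd (c₀ - 2) (by linear_combination hB0)
  · -- `c₁² = 4 − 2c₀`: `c₀² = 2`
    exact sq_ne_two_of_odd_finrank hodd c₀ (by linear_combination (-1 : K) * hB0 + c₀ * hc₁)

/-- **The minimal polynomial over an odd-degree number field `K` of any root of `X⁴ − 4X² + 2` (in any field extension) is `X⁴ − 4X² + 2`.**
Degrees `1` and `3` would give a root in `K`, degree `2` a relation `θ² = c₁θ + c₀`; both contradict `√2 ∉ K` (§1).  Equivalently: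
`ℚ(ζ₁₆)⁺ = ℚ(√(2+√2))` is linearly disjoint from `K`, `[K(√(2+√2)) : K] = 4`. [cite: Washington1997, §13.1 (`K_n = K·ℚ_n`, `[K_n : K] = 2ⁿ` for `K ∩ ℚ_∞ = ℚ`)] -/
theorem minpoly_eq_quartic_of_odd_finrank (hodd : Odd (Module.finrank ℚ K)) {L : Type*} [Field L] [Algebra K L] (θ : L)
    (hθ : θ ^ 4 - 4 * θ ^ 2 + 2 = 0) : minpoly K θ = X ^ 4 - C (4 : K) * X ^ 2 + C 2 := by
  have haeval : aeval θ (X ^ 4 - C (4 : K) * X ^ 2 + C 2 : K[X]) = 0 := by rw [aeval_quartic, hθ]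
  have hint : IsIntegral K θ := ⟨_, monic_quartic, by rw [← aeval_def]; exact haeval⟩
  have hdvd : minpoly K θ ∣ (X ^ 4 - C (4 : K) * X ^ 2 + C 2 : K[X]) := minpoly.dvd K θ haeval
  have hmonic : (minpoly K θ).Monic := minpoly.monic hint
  have hle : (minpoly K θ).natDegree ≤ 4 := natDegree_quartic (K := K) ▸ natDegree_le_of_dvd hdvd quartic_ne_zero'
  -- `θ ∉ K`
  have hθK : θ ∉ (algebraMap K L).range := by
    rintro ⟨x, rfl⟩
    have h0 : algebraMap K L (x ^ 4 - 4 * x ^ 2 + 2) = 0 := by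
      simp only [map_add, map_sub, map_mul, map_pow, map_ofNat]; exact hθ
    exact quartic_ne_zero_of_odd_finrank hodd x ((map_eq_zero_iff _ (algebraMap K L).injective).mp h0)
  have h2 : 2 ≤ (minpoly K θ).natDegree := (minpoly.two_le_natDegree_iff hint).mpr hθK
  -- it suffices that the degree is `4`
  suffices hdeg : (minpoly K θ).natDegree = 4 by
    symm
    exact eq_of_monic_of_dvd_of_natDegree_le hmonic monic_quartic hdvd (by rw [natDegree_quartic, hdeg])
  rcases (show (minpoly K θ).natDegree = 2 ∨ (minpoly K θ).natDegree = 3 ∨ (minpoly K θ).natDegree = 4 by omega) with hd | hd | hd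
  · -- degree `2`: `θ² = c₁θ + c₀`
    exfalso
    have hm := minpoly.aeval K θ
    rw [hmonic.as_sum, hd] at hm
    simp only [Finset.sum_range_succ, Finset.sum_range_zero, zero_add, pow_zero, mul_one, pow_one, map_add, map_pow, aeval_X,
      map_mul, aeval_C] at hm
    refine false_of_sq_eq_of_quartic_root hodd hθ hθK (-(minpoly K θ).coeff 0) (-(minpoly K θ).coeff 1) ?_
    rw [map_neg, map_neg]
    linear_combination hm
  · -- degree `3`: the cofactor is linear, so `X⁴ − 4X² + 2` has a root in `K`
    exfalso
    obtain ⟨g, hg⟩ := hdvd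
    have hg0 : g ≠ 0 := by
      intro h0; rw [h0, mul_zero] at hg; exact quartic_ne_zero' hg
    have hgdeg : g.natDegree = 1 := by
      have h := congrArg natDegree hg
      rw [natDegree_quartic, natDegree_mul hmonic.ne_zero hg0, hd] at h
      omega
    have hgmonic : g.Monic := hmonic.of_mul_monic_left (hg ▸ monic_quartic)
    have hgX : g = X + C (g.coeff 0) := hgmonic.eq_X_add_C hgdeg
    have hroot : eval (-g.coeff 0) (X ^ 4 - C (4 : K) * X ^ 2 + C 2 : K[X]) = 0 := by
      rw [hg, eval_mul, hgX]; simp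
    rw [eval_quartic] at hroot
    exact quartic_ne_zero_of_odd_finrank hodd _ hroot
  · exact hd

/-- **`X⁴ − 4X² + 2` is irreducible over a number field of odd degree.** [cite: Washington1997, §13.1] -/
theorem irreducible_quartic_of_odd_finrank (hodd : Odd (Module.finrank ℚ K)) :
    Irreducible (X ^ 4 - C (4 : K) * X ^ 2 + C 2 : K[X]) := by
  obtain ⟨θ, hθ⟩ := IsAlgClosed.exists_aeval_eq_zero (AlgebraicClosure K) (X ^ 4 - C (4 : K) * X ^ 2 + C 2 : K[X])
    (by rw [degree_eq_natDegree quartic_ne_zero', natDegree_quartic]; norm_num)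
  rw [aeval_quartic] at hθ
  have hint : IsIntegral K θ := Algebra.IsIntegral.isIntegral θ
  rw [← minpoly_eq_quartic_of_odd_finrank hodd θ hθ]
  exact minpoly.irreducible hint

/-- **`[K(θ) : K] = 4`** for a root `θ` of `X⁴ − 4X² + 2` in any extension of an odd-degree number field `K`. [cite: Washington1997, §13.1 (`[K_2 : K] = 4`)] -/
theorem finrank_adjoin_quartic_root (hodd : Odd (Module.finrank ℚ K)) {L : Type*} [Field L] [Algebra K L] (θ : L)
    (hθ : θ ^ 4 - 4 * θ ^ 2 + 2 = 0) : Module.finrank K K⟮θ⟯ = 4 := by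
  have hint : IsIntegral K θ := ⟨_, monic_quartic, by rw [← aeval_def, aeval_quartic, hθ]⟩
  rw [IntermediateField.adjoin.finrank hint, minpoly_eq_quartic_of_odd_finrank hodd θ hθ, natDegree_quartic]

/-- A degree-`4` extension of an odd-degree number field `K` containing a root of `X⁴ − 4X² + 2` is `K[X]/(X⁴ − 4X² + 2)`. [cite: Washington1997, §13.1] -/
private theorem nonempty_algEquiv_adjoinRoot_of_quartic_root (hodd : Odd (Module.finrank ℚ K))
    {L : Type*} [Field L] [Algebra K L] [FiniteDimensional K L] (hL : Module.finrank K L = 4) (θ : L) (hθ : θ ^ 4 - 4 * θ ^ 2 + 2 = 0) :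
    Nonempty (AdjoinRoot (X ^ 4 - C (4 : K) * X ^ 2 + C 2 : K[X]) ≃ₐ[K] L) := by
  have hint : IsIntegral K θ := Algebra.IsIntegral.isIntegral θ
  have hmin : (X ^ 4 - C (4 : K) * X ^ 2 + C 2 : K[X]) = minpoly K θ := (minpoly_eq_quartic_of_odd_finrank hodd θ hθ).symm
  have htop : K⟮θ⟯ = ⊤ := by
    apply IntermediateField.eq_of_le_of_finrank_eq le_top
    rw [finrank_adjoin_quartic_root hodd θ hθ, IntermediateField.finrank_top', hL]
  exact ⟨(AdjoinRoot.algEquivOfEq K _ _ hmin).trans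
    ((IntermediateField.adjoinRootEquivAdjoin K hint).trans ((IntermediateField.equivOfEq htop).trans IntermediateField.topEquiv))⟩

/-- **Two degree-`4` extensions of an odd-degree number field `K` each containing a root of `X⁴ − 4X² + 2` are `K`-isomorphic** (both are
`K[X]/(X⁴ − 4X² + 2)`; models of `K_2 = K·ℚ(ζ₁₆)⁺`). [cite: Washington1997, §13.1 (`K_2 = K·ℚ_2`)] -/
theorem nonempty_algEquiv_of_quartic_root_of_odd_finrank (hodd : Odd (Module.finrank ℚ K))
    {L₁ L₂ : Type*} [Field L₁] [Algebra K L₁] [FiniteDimensional K L₁] [Field L₂] [Algebra K L₂] [FiniteDimensional K L₂]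
    (h₁ : Module.finrank K L₁ = 4) (θ₁ : L₁) (hθ₁ : θ₁ ^ 4 - 4 * θ₁ ^ 2 + 2 = 0)
    (h₂ : Module.finrank K L₂ = 4) (θ₂ : L₂) (hθ₂ : θ₂ ^ 4 - 4 * θ₂ ^ 2 + 2 = 0) : Nonempty (L₁ ≃ₐ[K] L₂) := by
  obtain ⟨e₁⟩ := nonempty_algEquiv_adjoinRoot_of_quartic_root hodd h₁ θ₁ hθ₁
  obtain ⟨e₂⟩ := nonempty_algEquiv_adjoinRoot_of_quartic_root hodd h₂ θ₂ hθ₂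
  exact ⟨e₁.symm.trans e₂⟩

end Quartic

/-! ## §2 The model of the layer `K_2` and the transport of the narrow `p`-rank -/

section LayerTwo

/-- **`K_2 ∋ √(2+√2)`.**  For a number field `K` with `2 ∤ [K:ℚ]` and a cyclotomic `ℤ₂`-extension `κ` of `K`, the second layer `K_2 = κ.layer 2`
contains a root of `X⁴ − 4X² + 2` — `K_2 = K·ℚ_2 = K(ζ₁₆ + ζ₁₆⁻¹)` (Washington §13.1: `ℚ_2 = ℚ(ζ₁₆)⁺`).  Assembled exactly as the layer-`1` twin
`exists_sq_eq_two_layer_one_of_not_dvd_finrank`: `κ` is a unit twist of the restriction `κ_cyc ∘ res`, whose layers contain the images of the layers of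
`ℚ`, and `ℚ_2 ∋ ζ₁₆ + ζ₁₆⁻¹` (`CyclotomicZp.exists_mem_layer_two_quartic_zpExtension`). [cite: Washington1997, §13.1] -/
theorem exists_quartic_root_layer_two_of_not_dvd_finrank (hK : ¬ 2 ∣ Module.finrank ℚ K)
    (κ : ZpExtension K 2) (hκ : κ.IsCyclotomic) : ∃ θ : κ.layer 2, θ ^ 4 - 4 * θ ^ 2 + 2 = 0 := by
  have hsurj := ZpExtension.surjective_comp_absGaloisRestrict_of_not_dvd_finrank
    (CyclotomicZp.zpExtension 2) K hK
  have hcyc : ((CyclotomicZp.zpExtension 2).restrict K hsurj).IsCyclotomic :=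
    ZpExtension.isCyclotomic_restrict _ (CyclotomicZp.isCyclotomic_zpExtension 2) K hsurj
  obtain ⟨u, rfl⟩ := ZpExtension.IsCyclotomic.exists_eq_unitTwist_holds hcyc hκ
  obtain ⟨t, ht, -, ht4⟩ := CyclotomicZp.exists_mem_layer_two_quartic_zpExtension
  have hmem : absClosureEmbedding ℚ K t ∈
      (((CyclotomicZp.zpExtension 2).restrict K hsurj).unitTwist u).layer 2 := by
    rw [ZpExtension.layer_unitTwist]
    exact ZpExtension.absClosureEmbedding_mem_layer_restrict _ K hsurj 2 ht
  refine ⟨⟨absClosureEmbedding ℚ K t, hmem⟩, Subtype.ext ?_⟩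
  change (absClosureEmbedding ℚ K t) ^ 4 - 4 * (absClosureEmbedding ℚ K t) ^ 2 + 2 = (0 : AlgebraicClosure K)
  have h := congrArg (absClosureEmbedding ℚ K) ht4
  rw [map_add, map_sub, map_mul, map_pow, map_pow, map_ofNat, map_ofNat, map_zero] at h
  exact h

/-- **`K_2 ≃ₐ[K] L` for every extension `L/K` of degree `4` containing a root of `X⁴ − 4X² + 2`**, for every cyclotomic `ℤ₂`-extension `κ` of an
odd-degree number field `K` (`K_2 ∋ √(2+√2)` by `exists_quartic_root_layer_two_of_not_dvd_finrank`, `[K_2 : K] = 4`, §1).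
[cite: Washington1997, §13.1 (`ℚ_2 = ℚ(ζ₁₆)⁺`, `K_n = K·ℚ_n`)] -/
theorem nonempty_algEquiv_layer_two_of_quartic_root (hodd : Odd (Module.finrank ℚ K)) (κ : ZpExtension K 2) (hκ : κ.IsCyclotomic)
    (L : Type*) [Field L] [Algebra K L] [FiniteDimensional K L] (hL : Module.finrank K L = 4) (θ : L) (hθ : θ ^ 4 - 4 * θ ^ 2 + 2 = 0) :
    Nonempty (κ.layer 2 ≃ₐ[K] L) := by
  haveI : Fact (Nat.Prime 2) := ⟨Nat.prime_two⟩
  have hK : ¬ 2 ∣ Module.finrank ℚ K := fun h => (Nat.not_even_iff_odd.mpr hodd) (even_iff_two_dvd.mpr h)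
  obtain ⟨θ₂, hθ₂⟩ := exists_quartic_root_layer_two_of_not_dvd_finrank hK κ hκ
  haveI : FiniteDimensional K (κ.layer 2) := κ.finiteDimensional_layer_holds 2
  have h2 : Module.finrank K (κ.layer 2) = 4 := by rw [κ.finrank_layer_holds 2]; norm_num
  exact nonempty_algEquiv_of_quartic_root_of_odd_finrank hodd h2 θ₂ hθ₂ hL θ hθ

/-- **`[Cl⁺(K_2) : Cl⁺(K_2)^q] = [Cl⁺(L) : Cl⁺(L)^q]`** for every degree-`4` extension `L/K` with a root of `X⁴ − 4X² + 2` (`[K:ℚ]` odd, `κ` cyclotomic),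
any `NumberField` instance on the layer. [cite: Fukuda1994, Thm. 1 (2), p. 264 (`rank(A_2)`)] [cite: Washington1997, §13.1] -/
theorem index_range_pow_narrowClassGroup_layer_two_eq (hodd : Odd (Module.finrank ℚ K)) (κ : ZpExtension K 2) (hκ : κ.IsCyclotomic)
    (L : Type*) [Field L] [NumberField L] [Algebra K L] (hL : Module.finrank K L = 4) (θ : L) (hθ : θ ^ 4 - 4 * θ ^ 2 + 2 = 0) (q : ℕ)
    [NumberField (κ.layer 2)] :
    (powMonoidHom (α := NarrowClassGroup (κ.layer 2)) q).range.index = (powMonoidHom (α := NarrowClassGroup L) q).range.index := by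
  haveI : FiniteDimensional K L := Module.Finite.of_restrictScalars_finite ℚ K L
  obtain ⟨e⟩ := nonempty_algEquiv_layer_two_of_quartic_root hodd κ hκ L hL θ hθ
  exact index_range_pow_narrowClassGroup_eq_of_ringEquiv e.toRingEquiv q

end LayerTwo

/-! ## §3 The `n = 1` certificate with concrete models: `rank₂ Cl⁺(K_2) = rank₂ Cl⁺(K(√2))` -/

/-- **«NARROW `μ₂ = 0`» OF AN ODD-DEGREE NUMBER FIELD FROM ONE EQUALITY OF NARROW `2`-RANKS AT LAYERS `1` AND `2`.**  Let `K` be a number field of odd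
degree such that every cyclotomic `ℤ₂`-extension of `K` has Fukuda index `≤ 1` (index `0` — every prime above `2` ramified already in `K(√2)` — suffices by
`TotallyRamifiedFrom.mono`; tree criteria `forall_totallyRamifiedFrom_zero_of_not_dvd_discr`, `totallyRamifiedFrom_zero_of_evenIndexCertificate`); let `L₁/K` be
ANY quadratic extension containing a square root `θ₁` of `2` (a model of `K_1 = K(√2)`) and `L₂/K` ANY extension of degree `4` containing a root `θ₂` of
`X⁴ − 4X² + 2` (a model of `K_2 = K(√(2+√2))`), with **`[Cl⁺(L₂) : Cl⁺(L₂)²] = [Cl⁺(L₁) : Cl⁺(L₁)²]`** (`rank₂ Cl⁺(K_2) = rank₂ Cl⁺(K_1)`).  Then (a) Iwasawa's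
`μ₂ = 0` holds for every cyclotomic `ℤ₂`-extension of `K`, and (b) `ord₂ h⁺(K_m) ≤ ord₂ h(K_m) + max (ord₂ [Cl⁺(K):Cl⁺(K)²]) (ord₂ [Cl⁺(L₁):Cl⁺(L₁)²])` for every
cyclotomic `ℤ₂`-extension and every layer — hypotheses `hμ`, `D`, `hδ` of the Kida-lite ascent.  NARROW FUKUDA at `n₀ = n = 1` with the models of §2 and of
`NarrowFukudaCertificateLayerModels` — the rung to use when `rank₂ Cl⁺(K(√2)) > rank₂ Cl⁺(K)`.
[cite: Fukuda1994, Thm. 1 (2), p. 264] [cite: Washington1997, §13.1] [cite: Kida1982JFields, main theorem (μ-part; shape only)] -/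
theorem NarrowFukuda.narrowMu_of_layerTwo_model (K : Type) [Field K] [NumberField K] (hodd : Odd (Module.finrank ℚ K))
    (h1 : ∀ κ : ZpExtension K 2, κ.IsCyclotomic → TotallyRamifiedFrom κ 1)
    (L₁ : Type) [Field L₁] [NumberField L₁] [Algebra K L₁] (hL₁ : Module.finrank K L₁ = 2) (θ₁ : L₁) (hθ₁ : θ₁ ^ 2 = 2)
    (L₂ : Type) [Field L₂] [NumberField L₂] [Algebra K L₂] (hL₂ : Module.finrank K L₂ = 4) (θ₂ : L₂) (hθ₂ : θ₂ ^ 4 - 4 * θ₂ ^ 2 + 2 = 0)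
    (hr : (powMonoidHom (α := NarrowClassGroup L₂) 2).range.index = (powMonoidHom (α := NarrowClassGroup L₁) 2).range.index) :
    (∀ κ : ZpExtension K 2, κ.IsCyclotomic → ClassicalMuVanishes κ) ∧
    (∀ κ : ZpExtension K 2, κ.IsCyclotomic → ∀ m : ℕ, ∀ [NumberField (κ.layer m)],
      padicValNat 2 (narrowClassNumber (κ.layer m)) ≤ padicValNat 2 (classNumber (κ.layer m)) +
        max (padicValNat 2 (powMonoidHom (α := NarrowClassGroup K) 2).range.index)
          (padicValNat 2 (powMonoidHom (α := NarrowClassGroup L₁) 2).range.index)) := by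
  haveI : Fact (Nat.Prime 2) := ⟨Nat.prime_two⟩
  refine NarrowFukuda.narrowMu_of_narrowRankCertificate K 1
    (max (padicValNat 2 (powMonoidHom (α := NarrowClassGroup K) 2).range.index)
      (padicValNat 2 (powMonoidHom (α := NarrowClassGroup L₁) 2).range.index))
    fun κ hκ => ⟨h1 κ hκ, ?_, ?_⟩
  · intro _ _
    exact (index_range_pow_narrowClassGroup_layer_two_eq hodd κ hκ L₂ hL₂ θ₂ hθ₂ 2).trans
      (hr.trans (index_range_pow_narrowClassGroup_layer_one_eq hodd κ hκ L₁ hL₁ θ₁ hθ₁ 2).symm)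
  · intro m hm _
    rcases Nat.le_one_iff_eq_zero_or_eq_one.mp hm with rfl | rfl
    · rw [index_range_pow_narrowClassGroup_layer_zero_eq κ 2]
      exact le_max_left _ _
    · rw [index_range_pow_narrowClassGroup_layer_one_eq hodd κ hκ L₁ hL₁ θ₁ hθ₁ 2]
      exact le_max_right _ _

/-- **The same from Fukuda index `0`** (every prime above `2` ramifies already in `K_1 = K(√2)`; `TotallyRamifiedFrom.mono`).
[cite: Fukuda1994, Thm. 1 (2), p. 264] [cite: Washington1997, §13.1] -/
theorem NarrowFukuda.narrowMu_of_index_zero_of_layerTwo_model (K : Type) [Field K] [NumberField K] (hodd : Odd (Module.finrank ℚ K))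
    (h0 : ∀ κ : ZpExtension K 2, κ.IsCyclotomic → TotallyRamifiedFrom κ 0)
    (L₁ : Type) [Field L₁] [NumberField L₁] [Algebra K L₁] (hL₁ : Module.finrank K L₁ = 2) (θ₁ : L₁) (hθ₁ : θ₁ ^ 2 = 2)
    (L₂ : Type) [Field L₂] [NumberField L₂] [Algebra K L₂] (hL₂ : Module.finrank K L₂ = 4) (θ₂ : L₂) (hθ₂ : θ₂ ^ 4 - 4 * θ₂ ^ 2 + 2 = 0)
    (hr : (powMonoidHom (α := NarrowClassGroup L₂) 2).range.index = (powMonoidHom (α := NarrowClassGroup L₁) 2).range.index) :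
    (∀ κ : ZpExtension K 2, κ.IsCyclotomic → ClassicalMuVanishes κ) ∧
    (∀ κ : ZpExtension K 2, κ.IsCyclotomic → ∀ m : ℕ, ∀ [NumberField (κ.layer m)],
      padicValNat 2 (narrowClassNumber (κ.layer m)) ≤ padicValNat 2 (classNumber (κ.layer m)) +
        max (padicValNat 2 (powMonoidHom (α := NarrowClassGroup K) 2).range.index)
          (padicValNat 2 (powMonoidHom (α := NarrowClassGroup L₁) 2).range.index)) :=
  haveI : Fact (Nat.Prime 2) := ⟨Nat.prime_two⟩
  NarrowFukuda.narrowMu_of_layerTwo_model K hodd (fun κ hκ => (h0 κ hκ).mono zero_le_one) L₁ hL₁ θ₁ hθ₁ L₂ hL₂ θ₂ hθ₂ hr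

/-- **The fully explicit case `2 ∤ d_K`** (`2` unramified in the odd-degree field `K`, so Fukuda's index is `0` for every cyclotomic `ℤ₂`-extension by
`forall_totallyRamifiedFrom_zero_of_not_dvd_discr`): models `L₁ ≅ K(√2)`, `L₂ ≅ K(√(2+√2))` with `rank₂ Cl⁺(L₂) = rank₂ Cl⁺(L₁)` give (a) ∧ (b).
[cite: Fukuda1994, Thm. 1 (2), p. 264] [cite: Washington1997, §13.1 and Prop. 13.2] -/
theorem NarrowFukuda.narrowMu_of_not_dvd_discr_of_layerTwo_model (K : Type) [Field K] [NumberField K] (hodd : Odd (Module.finrank ℚ K))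
    (hd : ¬ (2 : ℤ) ∣ NumberField.discr K)
    (L₁ : Type) [Field L₁] [NumberField L₁] [Algebra K L₁] (hL₁ : Module.finrank K L₁ = 2) (θ₁ : L₁) (hθ₁ : θ₁ ^ 2 = 2)
    (L₂ : Type) [Field L₂] [NumberField L₂] [Algebra K L₂] (hL₂ : Module.finrank K L₂ = 4) (θ₂ : L₂) (hθ₂ : θ₂ ^ 4 - 4 * θ₂ ^ 2 + 2 = 0)
    (hr : (powMonoidHom (α := NarrowClassGroup L₂) 2).range.index = (powMonoidHom (α := NarrowClassGroup L₁) 2).range.index) :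
    (∀ κ : ZpExtension K 2, κ.IsCyclotomic → ClassicalMuVanishes κ) ∧
    (∀ κ : ZpExtension K 2, κ.IsCyclotomic → ∀ m : ℕ, ∀ [NumberField (κ.layer m)],
      padicValNat 2 (narrowClassNumber (κ.layer m)) ≤ padicValNat 2 (classNumber (κ.layer m)) +
        max (padicValNat 2 (powMonoidHom (α := NarrowClassGroup K) 2).range.index)
          (padicValNat 2 (powMonoidHom (α := NarrowClassGroup L₁) 2).range.index)) :=
  NarrowFukuda.narrowMu_of_index_zero_of_layerTwo_model K hodd
    (forall_totallyRamifiedFrom_zero_of_not_dvd_discr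
      (fun h => (Nat.not_even_iff_odd.mpr hodd) (even_iff_two_dvd.mpr h)) hd) L₁ hL₁ θ₁ hθ₁ L₂ hL₂ θ₂ hθ₂ hr

end Literature.NumberTheory.IwasawaTheory

end
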